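import Literature.NumberTheory.EllipticCurves.RootNumberProductFormulaProofs
import Literature.NumberTheory.EllipticCurves.RootNumberBCDTProofs
import HarnessLib

/-!
# `w(E/ℚ) = −∏_p w_p(E)`: the trust base of `WeierstrassCurve.rootNumber_eq_algebraicRootNumber`
in the tree

A `…Proofs` sibling (theorems only: no definition, no named fact, no instance; no statement of
`Literature.NumberTheory.EllipticCurves.RootNumber` is changed) written by the tenured seat of the
named fact `WeierstrassCurve.rootNumber_eq_algebraicRootNumber` (for an elliptic `W / ℚ` with no
additive reduction above `2, 3`, the analytic root number `W.rootNumber` — the sign of the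
functional equation of the entire continuation of `N_W^{s/2}(2π)^{-s}Γ(s)L(W, s)` — equals
`W.algebraicRootNumber = −∏ᶠ_v W.localRootNumberAt v`; Deligne 1973, Rohrlich 1994 §§19–21,
Kellock–Dokchitser 2023 Def. 2.1 and Rem. 2.2).

`RootNumberProductFormulaProofs` proves the fact from four named facts
(`rootNumber_eq_algebraicRootNumber_of_modularity`): modularity `existsUnique_isNewformOf`
(Breuil–Conrad–Diamond–Taylor 2001, Thm. A, at level the conductor), Hecke's functional equation
for newforms `IsNewform0.exists_functional_equation`, Atkin–Lehner's `ε(f) = ±1`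
`IsNewform0.frickeEigenvalue_eq_one_or_eq_neg_one`, and the local product formula for the Fricke
sign `frickeEigenvalue_eq_finprod_localRootNumberAt` (`ε(f_E) = ∏ᶠ_v w_v(E)`; Kellock–Dokchitser
2023, Rem. 2.2 with Atkin–Lehner 1970, Thm. 3). Since then two of the four have been **discharged**
in the tree — `IsNewform0.exists_functional_equation_holds` and
`IsNewform0.frickeEigenvalue_eq_one_or_eq_neg_one_holds` (`CuspFormLFunctionNewformFrickeProofs`;
Knapp 1993, Thm. 9.27 (PDF pp. 217–218 of the held copy): "`w_Q f = λ(Q) f` with `λ(Q) = ±1` …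
`w_N f = ∏_{p ∣ N} λ(Q) f`", and Thm. 9.8, Hecke's functional equation
`Λ(s, f) = ε (−1)^{k/2} Λ(k − s, f)` for `f ∈ S_k^ε(Γ₀(N))`, PDF p. 202) — and modularity has been
reduced to its printed inputs (`exists_isNewformOf_of_theoremB_of_CDT`, `BCDTModularity`). This
file only composes, so that the trust base of the fact inside the tree is recorded by single
searchable theorems (the companion of `RootNumberBCDTProofs` for
`hasFunctionalEquationSign_rootNumber`):

* `WeierstrassCurve.rootNumber_eq_algebraicRootNumber_of_existsUnique_isNewformOf` — the fact from
  modularity (`∃!` form) and the local product formula **only**;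
* `WeierstrassCurve.rootNumber_eq_algebraicRootNumber_of_exists_isNewformOf` — the same from the
  existence half `exists_isNewformOf` (Diamond–Shurman Thm. 8.8.3; uniqueness of the newform is
  the `q`-expansion principle, `existsUnique_isNewformOf_of_exists`);
* `WeierstrassCurve.rootNumber_eq_algebraicRootNumber_of_theoremB_of_CDT` — trust base
  {BCDT Thm. B, CDT Thm. 7.2.4, local product formula};
* `WeierstrassCurve.hasFunctionalEquationSign_algebraicRootNumber_of_exists_isNewformOf` and
  `WeierstrassCurve.algebraicRootNumber_eq_one_or_of_exists_isNewformOf` — the functional equation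
  with the algebraic sign, and `−∏ᶠ_v w_v(E) = ±1`, from the same two facts.

What remains undischarged for `rootNumber_eq_algebraicRootNumber_holds` is therefore exactly:
the Modularity Theorem (BCDT 2001, Thm. A) and the local product formula
`frickeEigenvalue_eq_finprod_localRootNumberAt`, whose deep input is Kellock–Dokchitser 2023,
Rem. 2.2 (PDF p. 7 of the held copy `paper:arxiv-2303.07883`): "For an elliptic curve defined
over `ℚ`, the local root number at a prime `p` agrees with the eigenvalue of the associated
Atkin–Lehner involution for the associated modular form. This follows from the corresponding
statement for modular forms (see [Schmidt 2002] Theorem 3.2.2, for example) together with the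
local Langlands conjecture for `GL₂` and the modularity of elliptic curves over `ℚ`."

## References

* [KellockDokchitser2023] L. Cowland Kellock, V. Dokchitser, *Root numbers and parity phenomena*,
  Bull. Lond. Math. Soc. 55 (2023), 2557–2597, Def. 2.1, Rem. 2.2, Thm. 2.3 (PDF pp. 7–8).
* [Knapp1993] A. W. Knapp, *Elliptic curves*, Math. Notes 40, Princeton 1993, Thm. 9.8, Thm. 9.27.
* [BCDTJAMS2001] C. Breuil, B. Conrad, F. Diamond, R. Taylor, J. Amer. Math. Soc. 14 (2001),
  Thm. A (= Thm. 2.2.2) and Thm. B.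
* [DiamondShurman2005] F. Diamond, J. Shurman, *A first course in modular forms*, GTM 228,
  Thm. 5.10.2, Thm. 8.8.3.
* [Rohrlich1994CRM] D. Rohrlich, *Elliptic curves and the Weil–Deligne group*, CRM Proc. Lecture
  Notes 4 (1994), 125–157, §§19–21 (not held; doi:10.1090/crmp/004/10, acquisition requested).
* [DeligneAntwerpII1973] P. Deligne, *Les constantes des équations fonctionnelles des fonctions L*,
  LNM 349 (1973).
-/

noncomputable section

namespace WeierstrassCurve

open Literature.NumberTheory.EllipticCurves.ModularForms Literature.NumberTheory.Automorphic.BCDT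
  IsDedekindDomain

variable (W : WeierstrassCurve ℚ)

/-- **`w(E/ℚ) = −∏_p w_p(E)` from the Modularity Theorem (`∃!` form) and the local product
formula only.** The named fact `W.rootNumber_eq_algebraicRootNumber` (Kellock–Dokchitser 2023,
Def. 2.1 with Rem. 2.2; Rohrlich 1994, §20) from `existsUnique_isNewformOf` (BCDT 2001, Thm. A, at
level the conductor) and `W.frickeEigenvalue_eq_finprod_localRootNumberAt`:
`rootNumber_eq_algebraicRootNumber_of_modularity` (`RootNumberProductFormulaProofs`) with its two
modular-forms inputs discharged — Hecke's functional equation for newforms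
(`IsNewform0.exists_functional_equation_holds`) and Atkin–Lehner's `ε(f) = ±1`
(`IsNewform0.frickeEigenvalue_eq_one_or_eq_neg_one_holds`; Knapp 1993, Thm. 9.27).
[cite: KellockDokchitser2023, Def. 2.1 and Rem. 2.2] [cite: Knapp1993, Thm. 9.27] -/
theorem rootNumber_eq_algebraicRootNumber_of_existsUnique_isNewformOf
    (hmod : existsUnique_isNewformOf) (hloc : W.frickeEigenvalue_eq_finprod_localRootNumberAt) :
    W.rootNumber_eq_algebraicRootNumber :=
  W.rootNumber_eq_algebraicRootNumber_of_modularity hmod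
    (fun _ _ ↦ IsNewform0.exists_functional_equation_holds)
    (fun _ _ ↦ IsNewform0.frickeEigenvalue_eq_one_or_eq_neg_one_holds) hloc

/-- **`w(E/ℚ) = −∏_p w_p(E)` from the Modularity Theorem, Version `L`, and the local product
formula.** The same from the existence half `exists_isNewformOf` (Diamond–Shurman Thm. 8.8.3;
BCDT 2001, Thm. A): uniqueness of the attached newform is the `q`-expansion principle
(`existsUnique_isNewformOf_of_exists`). This is the shape in which future discharges
`exists_isNewformOf_holds` and `frickeEigenvalue_eq_finprod_localRootNumberAt_holds` would close
the fact (Kellock–Dokchitser 2023, Def. 2.1 and Rem. 2.2).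
[cite: KellockDokchitser2023, Def. 2.1 and Rem. 2.2] [cite: DiamondShurman2005, Thm. 8.8.3] -/
theorem rootNumber_eq_algebraicRootNumber_of_exists_isNewformOf (hmod : exists_isNewformOf)
    (hloc : W.frickeEigenvalue_eq_finprod_localRootNumberAt) :
    W.rootNumber_eq_algebraicRootNumber :=
  W.rootNumber_eq_algebraicRootNumber_of_existsUnique_isNewformOf
    (existsUnique_isNewformOf_of_exists hmod) hloc

/-- **`w(E/ℚ) = −∏_p w_p(E)` from BCDT Theorem B, CDT Theorem 7.2.4 and the local product
formula.** Breuil–Conrad–Diamond–Taylor's Theorem B (`theoremB`) and Conrad–Diamond–Taylor's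
Thm. 7.2.4 (`CDT_theorem_7_2_4`) give the Modularity Theorem `exists_isNewformOf`
(`exists_isNewformOf_of_theoremB_of_CDT`, `BCDTModularity`), whence the fact by
`rootNumber_eq_algebraicRootNumber_of_exists_isNewformOf`. This theorem records the trust base
{Theorem B, CDT Thm. 7.2.4, `frickeEigenvalue_eq_finprod_localRootNumberAt`} of
`rootNumber_eq_algebraicRootNumber` in the tree (Kellock–Dokchitser 2023, Def. 2.1, Rem. 2.2).
[cite: BCDTJAMS2001, Theorem 2.2.2 and Theorem A] [cite: KellockDokchitser2023, Def. 2.1 and Rem. 2.2] -/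
theorem rootNumber_eq_algebraicRootNumber_of_theoremB_of_CDT (hB : theoremB)
    (hCDT : CDT_theorem_7_2_4) (hloc : W.frickeEigenvalue_eq_finprod_localRootNumberAt) :
    W.rootNumber_eq_algebraicRootNumber :=
  W.rootNumber_eq_algebraicRootNumber_of_exists_isNewformOf
    (exists_isNewformOf_of_theoremB_of_CDT hB hCDT) hloc

/-- **`Λ(E, 2 − s) = w_alg Λ(E, s)` with the algebraic sign `w_alg = −∏ᶠ_v w_v(E)`**, for an
elliptic `W / ℚ` with no additive reduction above `2, 3`, from the Modularity Theorem, Version `L`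
(`exists_isNewformOf`) and the local product formula only:
`hasFunctionalEquationSign_algebraicRootNumber_of_modularity` (`RootNumberProductFormulaProofs`)
with Hecke's functional equation discharged (`IsNewform0.exists_functional_equation_holds`)
(Kellock–Dokchitser 2023, Def. 2.1 and Rem. 2.2; Knapp 1993, Thm. 9.8 and Thm. 9.27).
[cite: KellockDokchitser2023, Def. 2.1 and Rem. 2.2] [cite: Knapp1993, Thm. 9.8 and Thm. 9.27] -/
theorem hasFunctionalEquationSign_algebraicRootNumber_of_exists_isNewformOf
    (hmod : exists_isNewformOf) (hloc : W.frickeEigenvalue_eq_finprod_localRootNumberAt)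
    [W.IsElliptic]
    (h23 : ∀ v : HeightOneSpectrum ℤ, W.HasAdditiveReductionAt v → 3 < ringChar (ℤ ⧸ v.asIdeal)) :
    W.HasFunctionalEquationSign W.algebraicRootNumber :=
  W.hasFunctionalEquationSign_algebraicRootNumber_of_modularity
    (existsUnique_isNewformOf_of_exists hmod)
    (fun _ _ ↦ IsNewform0.exists_functional_equation_holds) hloc h23

/-- **`−∏ᶠ_v w_v(E) = ±1`** for an elliptic `W / ℚ` with no additive reduction above `2, 3`, from
the Modularity Theorem, Version `L`, and the local product formula only (Kellock–Dokchitser 2023,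
Def. 2.1: `w(E/K) ∈ {±1}`): `algebraicRootNumber_eq_one_or_of_modularity` with Hecke's functional
equation and Atkin–Lehner's `ε(f) = ±1` discharged. [cite: KellockDokchitser2023, Def. 2.1] -/
theorem algebraicRootNumber_eq_one_or_of_exists_isNewformOf (hmod : exists_isNewformOf)
    (hloc : W.frickeEigenvalue_eq_finprod_localRootNumberAt) [W.IsElliptic]
    (h23 : ∀ v : HeightOneSpectrum ℤ, W.HasAdditiveReductionAt v → 3 < ringChar (ℤ ⧸ v.asIdeal)) :
    W.algebraicRootNumber = 1 ∨ W.algebraicRootNumber = -1 :=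
  W.algebraicRootNumber_eq_one_or_of_modularity (existsUnique_isNewformOf_of_exists hmod)
    (fun _ _ ↦ IsNewform0.exists_functional_equation_holds)
    (fun _ _ ↦ IsNewform0.frickeEigenvalue_eq_one_or_eq_neg_one_holds) hloc h23

end WeierstrassCurve

end
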